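import Summits.MatrixMultiplication.MatrixMultiplication.Theorems.SoloBlindConjEReduction

/-!
# The extremal families of Conjecture K♭ (sharpness on every layer)

Sub-programme (K₃) / Conjecture K♭ (K3.39): for a zero-sum-free `S` and a target `τ` with CORE `C = ⋃ {T ⊆ S : ∑_T = τ}`
of rank `ρ` and size `c`, conjecturally `K(τ; S) ≤ 1 + 2^{-ρ} - 2^{ρ - c}`.  This file certifies, in every rank `ρ ≥ 1` and on
every layer `ρ ≤ c ≤ 2ρ`, the family showing the bound cannot be lowered:

  `S(ρ, i₀) = {e_0, …, e_{ρ-1}} ∪ {p_i : i₀ ≤ i ≤ ρ - 1}`,  `p_i = e_0 + ⋯ + e_i`,  `τ = p_{ρ-1} = (1, …, 1)`,  `0 ≤ i₀ ≤ ρ`,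

as an indexed family `soloBlindFxH ρ : Bool × ℕ → (Fin ρ → ZMod 3)` (`(false, j) ↦ e_j`, `(true, i) ↦ p_i`; for `i₀ = 0` the value
`e_0 = p_0` occurs twice, which is allowed for sequences) on the index set `soloBlindFxS ρ i₀`.

* `soloBlindFx_zsf` — the family is zero-sum free on `S(ρ, i₀)` (look at the largest index occurring in a zero sum: that coordinate
  of the sum is `1` or `2`).
* `soloBlindFx_mass_ge` — `K(τ; S(ρ, i₀)) ≥ 1 + 2^{-ρ} - 2^{-(ρ - i₀)}`, from the explicit representations `{e_0, …, e_{ρ-1}}`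
  and `{e_{k+1}, …, e_{ρ-1}, p_k}` (`i₀ ≤ k ≤ ρ - 1`; for `k = ρ - 1` this is `{p_{ρ-1}}`) and the geometric sum `soloBlindFx_geom`.
* `soloBlindFx_card`, `soloBlindFx_core` — `|S(ρ, i₀)| = ρ + (ρ - i₀) =: c` and every element of `S(ρ, i₀)` lies in one of these
  representations, so `S(ρ, i₀)` is its own core; it contains the standard basis of `Fin ρ → ZMod 3`, so its rank is `ρ`, and the
  lower bound reads `1 + 2^{-ρ} - 2^{ρ - c}`: Conjecture K♭ is attained on every layer `(ρ, c)`, `ρ ≤ c ≤ 2ρ` (`c = ρ`: a basis,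
  `K = 2^{-ρ}`; `c = 2ρ`: `K = 1`).
-/

namespace Summit.MatrixMultiplication.MatrixMultiplication.Theorems

open Finset

/-- The family: `(false, j) ↦ e_j`, `(true, i) ↦ p_i = e_0 + ⋯ + e_i` (vectors `Fin ρ → ZMod 3`). -/
def soloBlindFxH (ρ : ℕ) : Bool × ℕ → (Fin ρ → ZMod 3)
  | (false, j) => fun k => if (k : ℕ) = j then 1 else 0
  | (true, i) => fun k => if (k : ℕ) ≤ i then 1 else 0

/-- The index set `S(ρ, i₀)`: every `e_j` (`j < ρ`) and the partial sums `p_i` (`i₀ ≤ i < ρ`). -/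
def soloBlindFxS (ρ i₀ : ℕ) : Finset (Bool × ℕ) :=
  (range ρ).image (fun j => (false, j)) ∪ (Ico i₀ ρ).image (fun i => (true, i))

/-- The target: the all-ones vector `p_{ρ-1}`. -/
def soloBlindFxTau (ρ : ℕ) : Fin ρ → ZMod 3 := fun _ => 1

/-- The representation `{e_{k+1}, …, e_{ρ-1}, p_k}` (for `k = ρ - 1` this is `{p_{ρ-1}}`). -/
def soloBlindFxR (ρ k : ℕ) : Finset (Bool × ℕ) :=
  (Ico (k + 1) ρ).image (fun j => (false, j)) ∪ {(true, k)}

/-- The representation `{e_0, …, e_{ρ-1}}`. -/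
def soloBlindFxRnone (ρ : ℕ) : Finset (Bool × ℕ) := (range ρ).image (fun j => (false, j))

/-- The map `j ↦ (false, j)` is injective. -/
theorem soloBlindFx_inj_false : Function.Injective (fun j : ℕ => ((false, j) : Bool × ℕ)) :=
  fun a b hab => by simpa using hab

/-- The map `i ↦ (true, i)` is injective. -/
theorem soloBlindFx_inj_true : Function.Injective (fun i : ℕ => ((true, i) : Bool × ℕ)) :=
  fun a b hab => by simpa using hab

/-- Coordinate `k` of `∑_{a ≤ j < ρ} e_j` is `[a ≤ k]`. -/
theorem soloBlindFx_sum_e (ρ a : ℕ) (k : Fin ρ) :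
    (∑ x ∈ (Ico a ρ).image (fun j => (false, j)), soloBlindFxH ρ x) k = if a ≤ (k : ℕ) then 1 else 0 := by
  rw [Finset.sum_apply, Finset.sum_image (fun a _ b _ hab => soloBlindFx_inj_false hab)]
  simp only [soloBlindFxH]
  rw [Finset.sum_ite_eq]
  simp only [Finset.mem_Ico, k.isLt, and_true]

/-- `{e_{k+1}, …, e_{ρ-1}, p_k}` represents the all-ones vector. -/
theorem soloBlindFx_sum_R (ρ k : ℕ) :
    ∑ x ∈ soloBlindFxR ρ k, soloBlindFxH ρ x = soloBlindFxTau ρ := by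
  have hdisj : Disjoint ((Ico (k + 1) ρ).image (fun j => (false, j))) ({(true, k)} : Finset (Bool × ℕ)) := by
    rw [Finset.disjoint_singleton_right, Finset.mem_image]
    rintro ⟨j, -, hj⟩
    simp at hj
  unfold soloBlindFxR
  rw [Finset.sum_union hdisj, Finset.sum_singleton]
  funext i
  rw [Pi.add_apply, soloBlindFx_sum_e]
  simp only [soloBlindFxH, soloBlindFxTau]
  by_cases h : k + 1 ≤ (i : ℕ)
  · rw [if_pos h, if_neg (by omega), add_zero]
  · rw [if_neg h, if_pos (by omega), zero_add]

/-- `{e_0, …, e_{ρ-1}}` represents the all-ones vector. -/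
theorem soloBlindFx_sum_Rnone (ρ : ℕ) :
    ∑ x ∈ soloBlindFxRnone ρ, soloBlindFxH ρ x = soloBlindFxTau ρ := by
  funext i
  unfold soloBlindFxRnone
  rw [Finset.range_eq_Ico, soloBlindFx_sum_e]
  simp [soloBlindFxTau]

/-- `{e_{k+1}, …, e_{ρ-1}, p_k} ⊆ S(ρ, i₀)` for `i₀ ≤ k < ρ`. -/
theorem soloBlindFx_R_subset {ρ i₀ k : ℕ} (hik : i₀ ≤ k) (hk : k < ρ) :
    soloBlindFxR ρ k ⊆ soloBlindFxS ρ i₀ := by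
  intro x hx
  unfold soloBlindFxR at hx
  unfold soloBlindFxS
  rw [Finset.mem_union] at hx ⊢
  rcases hx with hx | hx
  · left
    rw [Finset.mem_image] at hx ⊢
    obtain ⟨j, hj, rfl⟩ := hx
    exact ⟨j, by rw [Finset.mem_Ico] at hj; rw [Finset.mem_range]; omega, rfl⟩
  · right
    rw [Finset.mem_singleton] at hx
    rw [hx, Finset.mem_image]
    exact ⟨k, by rw [Finset.mem_Ico]; omega, rfl⟩

/-- `{e_0, …, e_{ρ-1}} ⊆ S(ρ, i₀)`. -/
theorem soloBlindFx_Rnone_subset (ρ i₀ : ℕ) : soloBlindFxRnone ρ ⊆ soloBlindFxS ρ i₀ :=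
  Finset.subset_union_left

/-- `|{e_{k+1}, …, e_{ρ-1}, p_k}| = ρ - k` for `k < ρ`. -/
theorem soloBlindFx_card_R {ρ k : ℕ} (hk : k < ρ) : (soloBlindFxR ρ k).card = ρ - k := by
  have hdisj : Disjoint ((Ico (k + 1) ρ).image (fun j => (false, j))) ({(true, k)} : Finset (Bool × ℕ)) := by
    rw [Finset.disjoint_singleton_right, Finset.mem_image]
    rintro ⟨j, -, hj⟩
    simp at hj
  unfold soloBlindFxR
  rw [Finset.card_union_of_disjoint hdisj, Finset.card_image_of_injective _ soloBlindFx_inj_false,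
    Nat.card_Ico, Finset.card_singleton]
  omega

/-- `|{e_0, …, e_{ρ-1}}| = ρ`. -/
theorem soloBlindFx_card_Rnone (ρ : ℕ) : (soloBlindFxRnone ρ).card = ρ := by
  unfold soloBlindFxRnone
  rw [Finset.card_image_of_injective _ soloBlindFx_inj_false, Finset.card_range]

/-- `(true, k)` is the unique `true`-indexed element of `{e_{k+1}, …, e_{ρ-1}, p_k}`. -/
theorem soloBlindFx_true_mem_R {ρ k k' : ℕ} (h : ((true, k') : Bool × ℕ) ∈ soloBlindFxR ρ k) : k' = k := by
  unfold soloBlindFxR at h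
  rw [Finset.mem_union, Finset.mem_image, Finset.mem_singleton] at h
  rcases h with ⟨j, -, hj⟩ | h
  · simp at hj
  · simpa using h

/-- No `true`-indexed element lies in `{e_0, …, e_{ρ-1}}`. -/
theorem soloBlindFx_true_not_mem_Rnone {ρ k : ℕ} : ((true, k) : Bool × ℕ) ∉ soloBlindFxRnone ρ := by
  unfold soloBlindFxRnone
  rw [Finset.mem_image]
  rintro ⟨j, -, hj⟩
  simp at hj

/-- `|S(ρ, i₀)| = ρ + (ρ - i₀)`. -/
theorem soloBlindFx_card (ρ i₀ : ℕ) : (soloBlindFxS ρ i₀).card = ρ + (ρ - i₀) := by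
  have hdisj : Disjoint ((range ρ).image (fun j => (false, j))) ((Ico i₀ ρ).image (fun i => ((true, i) : Bool × ℕ))) := by
    rw [Finset.disjoint_left]
    intro x hx hx'
    rw [Finset.mem_image] at hx hx'
    obtain ⟨j, -, rfl⟩ := hx
    obtain ⟨i, -, hi⟩ := hx'
    simp at hi
  unfold soloBlindFxS
  rw [Finset.card_union_of_disjoint hdisj, Finset.card_image_of_injective _ soloBlindFx_inj_false,
    Finset.card_image_of_injective _ soloBlindFx_inj_true, Finset.card_range, Nat.card_Ico]

/-- ZERO-SUM FREENESS of `S(ρ, i₀)`: in a zero sum look at the largest index `m` occurring; only `e_m` and `p_m` have a non-zero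
`m`-th coordinate among the summands, so that coordinate of the sum is `1` or `2`. -/
theorem soloBlindFx_zsf (ρ i₀ : ℕ) :
    ∀ T ⊆ soloBlindFxS ρ i₀, T.Nonempty → ∑ x ∈ T, soloBlindFxH ρ x ≠ 0 := by
  intro T hT hne hsum
  obtain ⟨x₀, hx₀, hmax⟩ := T.exists_max_image Prod.snd hne
  have hm : x₀.2 < ρ := by
    have hx := hT hx₀
    unfold soloBlindFxS at hx
    rw [Finset.mem_union, Finset.mem_image, Finset.mem_image] at hx
    rcases hx with ⟨j, hj, hjx⟩ | ⟨i, hi, hix⟩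
    · rw [← hjx]; simpa using hj
    · rw [← hix]; rw [Finset.mem_Ico] at hi; exact hi.2
  have hk := congrFun hsum ⟨x₀.2, hm⟩
  rw [Finset.sum_apply, Pi.zero_apply] at hk
  have hterm : ∀ x ∈ T, soloBlindFxH ρ x ⟨x₀.2, hm⟩ = if x.2 = x₀.2 then 1 else 0 := by
    intro x hx
    have hle := hmax x hx
    rcases x with ⟨b, j⟩
    cases b
    · simp only [soloBlindFxH]
      by_cases h : j = x₀.2
      · rw [if_pos h.symm, if_pos h]
      · rw [if_neg (fun h' => h h'.symm), if_neg h]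
    · simp only [soloBlindFxH]
      by_cases h : j = x₀.2
      · rw [if_pos (le_of_eq h.symm), if_pos h]
      · rw [if_neg (by simp at hle; omega), if_neg h]
  rw [Finset.sum_congr rfl hterm, Finset.sum_boole] at hk
  have hN1 : 1 ≤ (T.filter (fun x => x.2 = x₀.2)).card :=
    Finset.card_pos.2 ⟨x₀, Finset.mem_filter.2 ⟨hx₀, rfl⟩⟩
  have hN2 : (T.filter (fun x => x.2 = x₀.2)).card ≤ 2 := by
    calc (T.filter (fun x => x.2 = x₀.2)).card
        ≤ ({(false, x₀.2), (true, x₀.2)} : Finset (Bool × ℕ)).card := by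
          apply Finset.card_le_card
          intro x hx
          rw [Finset.mem_filter] at hx
          rcases x with ⟨b, j⟩
          obtain ⟨-, hj⟩ := hx
          simp only at hj
          subst hj
          cases b <;> simp
      _ ≤ 2 := Finset.card_le_two
  generalize (T.filter (fun x => x.2 = x₀.2)).card = N at hk hN1 hN2
  interval_cases N
  · exact absurd hk (by decide)
  · exact absurd hk (by decide)

/-- Membership of a representation in `soloBlindSeqRepAll`. -/
theorem soloBlindFx_R_mem_repAll {ρ i₀ k : ℕ} (hik : i₀ ≤ k) (hk : k < ρ) :
    soloBlindFxR ρ k ∈ soloBlindSeqRepAll (soloBlindFxH ρ) (soloBlindFxS ρ i₀) (soloBlindFxTau ρ) :=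
  soloBlind_mem_seqRepAll.2 ⟨soloBlindFx_R_subset hik hk, soloBlindFx_sum_R ρ k⟩

/-- Membership of `{e_0, …, e_{ρ-1}}` in `soloBlindSeqRepAll`. -/
theorem soloBlindFx_Rnone_mem_repAll (ρ i₀ : ℕ) :
    soloBlindFxRnone ρ ∈ soloBlindSeqRepAll (soloBlindFxH ρ) (soloBlindFxS ρ i₀) (soloBlindFxTau ρ) :=
  soloBlind_mem_seqRepAll.2 ⟨soloBlindFx_Rnone_subset ρ i₀, soloBlindFx_sum_Rnone ρ⟩

/-- CORE: every element of `S(ρ, i₀)` lies in one of the exhibited representations, so `S(ρ, i₀)` is its own core. -/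
theorem soloBlindFx_core {ρ i₀ : ℕ} :
    ∀ x ∈ soloBlindFxS ρ i₀, ∃ T ∈ soloBlindSeqRepAll (soloBlindFxH ρ) (soloBlindFxS ρ i₀) (soloBlindFxTau ρ), x ∈ T := by
  intro x hx
  unfold soloBlindFxS at hx
  rw [Finset.mem_union, Finset.mem_image, Finset.mem_image] at hx
  rcases hx with ⟨j, hj, rfl⟩ | ⟨i, hi, rfl⟩
  · exact ⟨_, soloBlindFx_Rnone_mem_repAll ρ i₀, Finset.mem_image_of_mem _ hj⟩
  · rw [Finset.mem_Ico] at hi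
    refine ⟨_, soloBlindFx_R_mem_repAll hi.1 hi.2, ?_⟩
    unfold soloBlindFxR
    exact Finset.mem_union_right _ (Finset.mem_singleton_self _)

/-- The geometric sum `∑_{i₀ ≤ k ≤ ρ-1} 2^{-(ρ-k)} = 1 - 2^{-(ρ-i₀)}` (`i₀ ≤ ρ`). -/
theorem soloBlindFx_geom : ∀ ρ i₀ : ℕ, i₀ ≤ ρ →
    ∑ k ∈ Ico i₀ ρ, (1 / 2 : ℚ) ^ (ρ - k) = 1 - (1 / 2 : ℚ) ^ (ρ - i₀) := by
  intro ρ
  induction ρ with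
  | zero =>
    intro i₀ hi
    obtain rfl : i₀ = 0 := Nat.le_zero.1 hi
    simp
  | succ ρ ih =>
    intro i₀ hi
    rcases Nat.lt_or_ge i₀ (ρ + 1) with hlt | hge
    · rw [Finset.sum_eq_sum_Ico_succ_bot hlt]
      have e : ∑ k ∈ Ico (i₀ + 1) (ρ + 1), (1 / 2 : ℚ) ^ (ρ + 1 - k)
          = ∑ k ∈ Ico i₀ ρ, (1 / 2 : ℚ) ^ (ρ - k) := by
        rw [← Finset.sum_Ico_add' (fun k => (1 / 2 : ℚ) ^ (ρ + 1 - k)) i₀ ρ 1]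
        exact Finset.sum_congr rfl (fun k _ => by rw [Nat.add_sub_add_right])
      rw [e, ih i₀ (by omega), show ρ + 1 - i₀ = (ρ - i₀) + 1 by omega, pow_succ]
      ring
    · obtain rfl : i₀ = ρ + 1 := le_antisymm hi hge
      simp

/-- SHARPNESS OF K♭ ON EVERY LAYER: `K(τ; S(ρ, i₀)) ≥ 1 + 2^{-ρ} - 2^{-(ρ - i₀)}` for `i₀ ≤ ρ`
(with `c = |S(ρ, i₀)| = 2ρ - i₀` this is `1 + 2^{-ρ} - 2^{ρ - c}`; `i₀ = ρ` is the bare basis, `i₀ = 0` the doubled top layer). -/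
theorem soloBlindFx_mass_ge {ρ i₀ : ℕ} (hi : i₀ ≤ ρ) :
    1 + (1 / 2 : ℚ) ^ ρ - (1 / 2 : ℚ) ^ (ρ - i₀)
      ≤ soloBlindMass (soloBlindFxH ρ) (soloBlindFxS ρ i₀) (soloBlindFxTau ρ) := by
  set 𝒯 : Finset (Finset (Bool × ℕ)) := insert (soloBlindFxRnone ρ) ((Ico i₀ ρ).image (soloBlindFxR ρ)) with h𝒯
  have hsub : 𝒯 ⊆ soloBlindSeqRepAll (soloBlindFxH ρ) (soloBlindFxS ρ i₀) (soloBlindFxTau ρ) := by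
    intro T hT
    rw [h𝒯, Finset.mem_insert, Finset.mem_image] at hT
    rcases hT with rfl | ⟨k, hk, rfl⟩
    · exact soloBlindFx_Rnone_mem_repAll ρ i₀
    · rw [Finset.mem_Ico] at hk
      exact soloBlindFx_R_mem_repAll hk.1 hk.2
  have hnot : soloBlindFxRnone ρ ∉ (Ico i₀ ρ).image (soloBlindFxR ρ) := by
    rw [Finset.mem_image]
    rintro ⟨k, -, hk⟩
    have hmem : ((true, k) : Bool × ℕ) ∈ soloBlindFxR ρ k := by
      unfold soloBlindFxR
      exact Finset.mem_union_right _ (Finset.mem_singleton_self _)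
    rw [hk] at hmem
    exact soloBlindFx_true_not_mem_Rnone hmem
  have hinj : ∀ k ∈ Ico i₀ ρ, ∀ k' ∈ Ico i₀ ρ, soloBlindFxR ρ k = soloBlindFxR ρ k' → k = k' := by
    intro k _ k' _ hkk
    have hmem : ((true, k) : Bool × ℕ) ∈ soloBlindFxR ρ k := by
      unfold soloBlindFxR
      exact Finset.mem_union_right _ (Finset.mem_singleton_self _)
    rw [hkk] at hmem
    exact soloBlindFx_true_mem_R hmem
  have hval : ∑ T ∈ 𝒯, (1 / 2 : ℚ) ^ T.card = (1 / 2 : ℚ) ^ ρ + (1 - (1 / 2 : ℚ) ^ (ρ - i₀)) := by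
    rw [h𝒯, Finset.sum_insert hnot, Finset.sum_image hinj, soloBlindFx_card_Rnone, ← soloBlindFx_geom ρ i₀ hi]
    congr 1
    exact Finset.sum_congr rfl (fun k hk => by rw [Finset.mem_Ico] at hk; rw [soloBlindFx_card_R hk.2])
  calc 1 + (1 / 2 : ℚ) ^ ρ - (1 / 2 : ℚ) ^ (ρ - i₀)
      = ∑ T ∈ 𝒯, (1 / 2 : ℚ) ^ T.card := by rw [hval]; ring
    _ ≤ soloBlindMass (soloBlindFxH ρ) (soloBlindFxS ρ i₀) (soloBlindFxTau ρ) :=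
        Finset.sum_le_sum_of_subset_of_nonneg hsub (fun T _ _ => by positivity)

end Summit.MatrixMultiplication.MatrixMultiplication.Theorems
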